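import Summits.Ventures.PercRepro.RLSRuleTraces
import Summits.Ventures.PercRepro.RLSRuleCoplanar

/-!
# PercRepro — the plane «`3`-point line + point»: its triples, its traces and the good witnesses (night-3, gen 3)

Geometry of `G = ℓ ∪ {a}` (`|ℓ| = 3`, rank `2`, `a ∉ ℓ`) on a matroid simple on `G`:

* `indep_of_ne_line`: the `3`-subsets of `G` other than `ℓ` are independent; `rho3_three_line_point`: `ρ₃(G) = 3`;
* `coplanarTriples M ℓ K`: the `3`-subsets of `K` coplanar with `ℓ` (at most one, `card_coplanar_triples_le_one`);
  `GoodWitness M ℓ K X`: `X` contains none of them;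
* `mstar_union_eq_zero_of_good`: in a good witness `G ∪ X` every trace is in `𝒯₀` — a plane `G' ≠ G` meets `G` in
  `≤ 3` points, in exactly `3` only along `ℓ`, and then in `≤ 2` points of `X` (three would be a coplanar triple
  inside `X`); no trace has a long line (`hasLongLine_of_union`);
* `wPlus_union_ge_of_good`: so `G` receives at least `3 / C(4 + |X|, 3)` there.
Imports `RLSRuleTraces`, `RLSRuleCoplanar`.  Axioms: standard.
-/

open scoped Matroid

namespace PercRepro

namespace NightThree

open Finset ThmH PerFlat

variable {α : Type*} [DecidableEq α] {M : Matroid α} [M.Finite]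

/-- The `3`-subsets of `G = ℓ ∪ {a}` other than `ℓ` are independent. -/
theorem indep_of_ne_line {G ℓ T : Finset α} (hG : G ∈ flatsQ M 3) (hℓG : ℓ ⊆ G) (hℓr : M.eRk (ℓ : Set α) = 2)
    (hℓc : ℓ.card = 3) (hGc : G.card = 4) (hsimple : SimpleOn M G) (hT : T ⊆ G) (hTc : T.card = 3)
    (hne : T ≠ ℓ) : M.Indep (T : Set α) := by
  -- `T` has two points of `ℓ` and the point `a ∉ ℓ`
  have hTℓ : 2 ≤ (T ∩ ℓ).card := by
    have h1 := Finset.card_union_add_card_inter T ℓ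
    have h2 : (T ∪ ℓ).card ≤ 4 := by rw [← hGc]; exact Finset.card_le_card (Finset.union_subset hT hℓG)
    omega
  have hTℓ' : (T ∩ ℓ).card ≤ 2 := by
    by_contra h
    push Not at h
    have heq : T ∩ ℓ = T := Finset.eq_of_subset_of_card_le Finset.inter_subset_left (by omega)
    have heq' : T ∩ ℓ = ℓ := Finset.eq_of_subset_of_card_le Finset.inter_subset_right (by omega)
    exact hne (heq.symm.trans heq')
  obtain ⟨a, haT, haℓ⟩ : ∃ a ∈ T, a ∉ ℓ := by
    by_contra h
    push Not at h
    have : T ⊆ ℓ := h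
    have := Finset.card_le_card (Finset.subset_inter (le_refl T) this)
    omega
  -- `ρ(T) = 3`: `a ∉ cl(T ∩ ℓ) = cl ℓ`
  obtain ⟨u, v, huv, hP⟩ := Finset.card_eq_two.1 (le_antisymm hTℓ' hTℓ)
  have hPℓ : ({u, v} : Finset α) ⊆ ℓ := hP ▸ Finset.inter_subset_right
  have hPT : ({u, v} : Finset α) ⊆ T := hP ▸ Finset.inter_subset_left
  have hPr : M.eRk (({u, v} : Finset α) : Set α) = 2 := by
    rw [Finset.coe_pair]
    exact hsimple u (hℓG (hPℓ (by simp))) v (hℓG (hPℓ (by simp))) huv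
  have hℓE : (ℓ : Set α) ⊆ M.E := by
    rw [← coe_gr M]; exact Finset.coe_subset.2 (hℓG.trans (mem_flatsQ.1 hG).1)
  have hclP : M.closure (({u, v} : Finset α) : Set α) = M.closure (ℓ : Set α) := by
    apply closure_eq_of_subset_flat (M.isFlat_closure _)
      ((Finset.coe_subset.2 hPℓ).trans (M.subset_closure _ hℓE)) (Finset.finite_toSet _)
    rw [M.eRk_closure_eq, hPr, hℓr]
  have haE : a ∈ M.E := by rw [← coe_gr M]; exact Finset.mem_coe.2 ((hT.trans (mem_flatsQ.1 hG).1) haT)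
  have hacl : a ∉ M.closure (ℓ : Set α) := by
    intro hacl
    -- then `G ⊆ cl ℓ` has rank `2`
    have hGsub : (G : Set α) ⊆ M.closure (ℓ : Set α) := by
      intro x hx
      by_cases hxℓ : x ∈ ℓ
      · exact M.subset_closure _ hℓE (Finset.mem_coe.2 hxℓ)
      · -- `G = ℓ ∪ {a}`: a point of `G` off `ℓ` is `a`
        have hx' : x = a := by
          by_contra hxa
          have : (insert x (insert a ℓ)).card ≤ G.card := Finset.card_le_card (by
            intro y hy
            rcases Finset.mem_insert.1 hy with rfl | hy
            · exact Finset.mem_coe.1 hx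
            · rcases Finset.mem_insert.1 hy with rfl | hy
              · exact hT haT
              · exact hℓG hy)
          rw [Finset.card_insert_of_notMem (by
              intro h; rcases Finset.mem_insert.1 h with h | h
              · exact hxa h
              · exact hxℓ h),
            Finset.card_insert_of_notMem haℓ, hℓc, hGc] at this
          omega
        rw [hx']
        exact hacl
    have := M.eRk_mono hGsub
    rw [M.eRk_closure_eq, hℓr, eRk_eq_three_of_mem_flatsQ' hG] at this
    exact absurd this (by norm_num)
  have h3 : M.eRk (insert a (({u, v} : Finset α) : Set α)) = 3 := by
    rw [Matroid.eRk_insert_eq_add_one ⟨haE, by rw [hclP]; exact hacl⟩, hPr]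
    rfl
  have hTeq : (T : Set α) = insert a (({u, v} : Finset α) : Set α) := by
    have hsub : insert a ({u, v} : Finset α) ⊆ T := Finset.insert_subset haT hPT
    have hc : (insert a ({u, v} : Finset α)).card = 3 := by
      rw [Finset.card_insert_of_notMem (by
        intro h
        exact haℓ (hPℓ h)), Finset.card_pair huv]
    have := Finset.eq_of_subset_of_card_le hsub (by omega)
    rw [← this, Finset.coe_insert]
  rw [Matroid.indep_iff_eRk_eq_encard_of_finite T.finite_toSet, hTeq, h3, ← hTeq,
    Set.encard_coe_eq_coe_finsetCard, hTc]
  rfl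

/-- `ρ₃(ℓ ∪ {a}) = 3`. -/
theorem rho3_three_line_point {G ℓ : Finset α} (hG : G ∈ flatsQ M 3) (hℓG : ℓ ⊆ G)
    (hℓr : M.eRk (ℓ : Set α) = 2) (hℓc : ℓ.card = 3) (hGc : G.card = 4) (hsimple : SimpleOn M G) :
    rho3 M G = 3 := by
  classical
  unfold rho3
  have hfilter : (G.powersetCard 3).filter (fun (T : Finset α) => M.Indep (T : Set α)) =
      (G.powersetCard 3).erase ℓ := by
    ext T
    rw [Finset.mem_filter, Finset.mem_erase, Finset.mem_powersetCard]
    constructor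
    · rintro ⟨⟨hTG, hTc⟩, hTi⟩
      refine ⟨?_, hTG, hTc⟩
      rintro rfl
      have := eRk_eq_three_of_indep_card hTi hTc
      rw [hℓr] at this
      exact absurd this (by norm_num)
    · rintro ⟨hne, hTG, hTc⟩
      exact ⟨⟨hTG, hTc⟩, indep_of_ne_line hG hℓG hℓr hℓc hGc hsimple hTG hTc hne⟩
  rw [hfilter, Finset.card_erase_of_mem (Finset.mem_powersetCard.2 ⟨hℓG, hℓc⟩), Finset.card_powersetCard, hGc]
  rfl

/-- The coplanar triples of `K` over `ℓ`. -/
noncomputable def coplanarTriples (M : Matroid α) (ℓ K : Finset α) : Finset (Finset α) :=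
  (K.powersetCard 3).filter (fun C => M.eRk ((ℓ ∪ C : Finset α) : Set α) ≤ 3)

/-- A witness is GOOD when it contains no coplanar triple. -/
def GoodWitness (M : Matroid α) (ℓ K X : Finset α) : Prop := ∀ C ∈ coplanarTriples M ℓ K, ¬ C ⊆ X

/-- In a good witness `G ∪ X` every trace is in `𝒯₀` (`G = ℓ ∪ {a}`). -/
theorem mstar_union_eq_zero_of_good {G ℓ K X : Finset α} (hG : G ∈ flatsQ M 3) (hℓG : ℓ ⊆ G)
    (hℓr : M.eRk (ℓ : Set α) = 2) (hℓc : ℓ.card = 3) (hGc : G.card = 4) (hsimple : SimpleOn M G)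
    (hX : M.Indep (X : Set α)) (hXG : Disjoint X G) (hXK : X ⊆ K) (hgood : GoodWitness M ℓ K X) :
    mstar M (G ∪ X) = 0 := by
  rw [mstar_eq_zero_iff]
  intro G' hG' hn
  obtain ⟨_, hbig⟩ := hn
  rcases hbig with h6 | hline
  · by_cases hGG : G' = G
    · rw [hGG, inter_union_eq_of_disjoint le_rfl hXG] at h6
      omega
    · have hle := card_inter_union_le (B := G) (X := X) hG' hX
      -- `|G' ∩ G| ≤ 3`, and `= 3` only for the trace `ℓ`
      have h3 : (G' ∩ G).card ≤ 3 := by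
        by_contra h
        push Not at h
        have heq : G' ∩ G = G := Finset.eq_of_subset_of_card_le Finset.inter_subset_right (by omega)
        have hGG' : G ⊆ G' := by rw [← heq]; exact Finset.inter_subset_left
        have hG3 : M.eRk (G : Set α) = 3 := eRk_eq_three_of_mem_flatsQ' hG
        rw [flatsQ_three] at hG hG'
        exact hGG (planes_eq_of_subset hG' hG hGG' le_rfl hG3)
      rcases lt_or_eq_of_le h3 with hlt | heq3
      · omega
      · -- `G' ∩ G = ℓ` (a `3`-subset that is not `ℓ` would span `G`)
        have hGGℓ : G' ∩ G = ℓ := by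
          by_contra hne
          have hind := indep_of_ne_line hG hℓG hℓr hℓc hGc hsimple Finset.inter_subset_right heq3 hne
          have h3' : M.eRk ((G' ∩ G : Finset α) : Set α) = 3 := eRk_eq_three_of_indep_card hind heq3
          rw [flatsQ_three] at hG hG'
          exact hGG (planes_eq_of_subset hG' hG Finset.inter_subset_left Finset.inter_subset_right h3')
        -- then `|G' ∩ X| ≤ 2`: three points of `X` in `G'` would be a coplanar triple inside `X`
        have hGX : (G' ∩ X).card ≤ 2 := by
          by_contra h
          push Not at h
          have hind : M.Indep ((G' ∩ X : Finset α) : Set α) :=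
            hX.subset (Finset.coe_subset.2 Finset.inter_subset_right)
          have hle3 : M.eRk ((G' ∩ X : Finset α) : Set α) ≤ 3 := by
            rw [← eRk_eq_three_of_mem_flatsQ' hG']
            exact M.eRk_mono (Finset.coe_subset.2 Finset.inter_subset_left)
          rw [eRk_eq_card_of_indep hind] at hle3
          have hc3 : (G' ∩ X).card = 3 := le_antisymm (by exact_mod_cast hle3) h
          apply hgood (G' ∩ X)
          · unfold coplanarTriples
            rw [Finset.mem_filter, Finset.mem_powersetCard]
            refine ⟨⟨Finset.inter_subset_right.trans hXK, hc3⟩, ?_⟩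
            rw [← eRk_eq_three_of_mem_flatsQ' hG']
            apply M.eRk_mono
            rw [Finset.coe_union]
            apply Set.union_subset
            · rw [← hGGℓ, Finset.coe_inter]; exact Set.inter_subset_left
            · rw [Finset.coe_inter]; exact Set.inter_subset_left
          · exact Finset.inter_subset_right
        have : (G' ∩ (G ∪ X)).card ≤ (G' ∩ G).card + (G' ∩ X).card := by
          rw [Finset.inter_union_distrib_left]; exact Finset.card_union_le _ _
        omega
  · have hlong := hasLongLine_of_union hG hsimple le_rfl hX hXG Finset.inter_subset_right hline
    obtain ⟨L, hL, hr⟩ := hlong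
    rw [Finset.mem_powersetCard] at hL
    have hLG : L = G := Finset.eq_of_subset_of_card_le hL.1 (by omega)
    rw [hLG, eRk_eq_three_of_mem_flatsQ' hG] at hr
    exact absurd hr (by norm_num)

/-- In a good witness, `G = ℓ ∪ {a}` receives at least `3 / C(4 + |X|, 3)`. -/
theorem wPlus_union_ge_of_good {G ℓ K X : Finset α} (hG : G ∈ flatsQ M 3) (hℓG : ℓ ⊆ G)
    (hℓr : M.eRk (ℓ : Set α) = 2) (hℓc : ℓ.card = 3) (hGc : G.card = 4) (hsimple : SimpleOn M G)
    (hX : M.Indep (X : Set α)) (hXG : Disjoint X G) (hXK : X ⊆ K) (hgood : GoodWitness M ℓ K X) :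
    3 / (((4 + X.card).choose 3 : ℕ) : ℚ) ≤ wPlus M G (G ∪ X) := by
  have hS : G ∪ X ⊆ gr M := by
    apply Finset.union_subset (mem_flatsQ.1 hG).1
    rw [← Finset.coe_subset, coe_gr]
    exact hX.subset_ground
  have h := wPlus_ge_of_mstar_zero hS
    (mstar_union_eq_zero_of_good hG hℓG hℓr hℓc hGc hsimple hX hXG hXK hgood) G
  rw [inter_union_eq_of_disjoint le_rfl hXG, rho3_three_line_point hG hℓG hℓr hℓc hGc hsimple,
    Finset.card_union_of_disjoint hXG.symm, hGc] at h
  exact_mod_cast h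

end NightThree

end PercRepro
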